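import Mathlib
import HarnessLib
import Summits.RiemannHypothesis.RiemannHypothesis.Theorems.IntegerScrewRungCertSeries

/-!
# Route `IntegerScrew` — kernel certificate checker for the finite rungs (3/3: soundness)

The screw entries in computable pieces (`uR_eq`: `Ψ(log(a/b)) − C/4` through `√a√b`, the prime sum over
`n ≤ a/b`, the linear term and the geometric Hurwitz–Lerch series at `b²/a²` — Suzuki2023 (1.1) with
`|t| = log a − log b`, `e^{±t/2} = √a√b/b, √a√b/a`, `⌊e^t⌋ = a/b`, `e^{−2tk} = (b²/a²)^k`), their
enclosure `mem_uEncl`, the matrix `T(c) = (c/4)(I + J) + U` with `screwMatrix N = T(C)`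
(`screwMatrix_eq_tMat`), the rank-one split `T(C) = T(c_lo) + ((C − c_lo)/4)(I + J)` (`tMat_split`,
`one_add_vecMulVec_posSemidef`), the centre/radius reading (`abs_sub_midQ_le_radQ`), and the MAIN
SOUNDNESS THEOREM `posDef_of_rungCheck : rungCheck N logs utab cert = true → (screwMatrix N).PosDef`,
with the corollary `screwPivot_pos_of_rungCheck` (`d_M > 0`, `2 ≤ M ≤ N + 1`, via the nested Sylvester
criterion `screwPivot_pos_of_posDef_le`). The generic decision step is the tree's
`Literature.Analysis.ValidatedNumerics.posDef_of_checkLower`. Nothing here bears on the truth of RH.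
References: M. Suzuki, J. Lond. Math. Soc. (2) 108 (2023), (1.1), (1.4) [Suzuki2023]; S. M. Rump, Acta
Numerica 19 (2010) §10.8 [folklore].
-/

set_option linter.dupNamespace false

namespace Summit.RiemannHypothesis.RiemannHypothesis.Theorems.IntegerScrew.RungCert

open Literature.NumberTheory.LFunctions Literature.Analysis.ValidatedNumerics
open Literature.Analysis.ValidatedNumerics.Numerics Finset
open scoped BigOperators

/-! ## The screw entries: `u(a,b) = Ψ(log(a/b)) − C/4` and the matrix `T(c)` -/

/-- `C = ζ(2,¼) = Σ_k (k+¼)^{-2}` (the constant of Suzuki2023 (1.1)). [folklore] -/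
noncomputable def lerchC : ℝ := ∑' k : ℕ, 1 / ((k : ℝ) + 1 / 4) ^ 2

/-- `A = γ₀ + π/2 + 3 log 2 + log π` (the slope of the linear term of `Ψ`). [folklore] -/
noncomputable def slopeA : ℝ := Real.eulerMascheroniConstant + Real.pi / 2 + 3 * Real.log 2 + Real.log Real.pi

/-- `u(a,b) = Ψ(log(a/b)) − C/4`. [folklore] -/
noncomputable def uR (a b : ℕ) : ℝ := zetaScrew (Real.log ((a : ℝ) / b)) - lerchC / 4

/-- `T(c)`: the screw Gram matrix with the constant `C` of the PSD rank-one pattern `(C/4)(I + J)`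
replaced by `c`: `T(c)_{ii} = c/2 + 2u(i+2,1)`, `T(c)_{ij} = c/4 + u(i+2,1) + u(j+2,1) − u(max, min)`. [folklore] -/
noncomputable def tMat (c : ℝ) (N : ℕ) : Matrix (Fin N) (Fin N) ℝ := Matrix.of fun i j =>
  if i = j then c / 2 + 2 * uR ((i : ℕ) + 2) 1
  else c / 4 + uR ((i : ℕ) + 2) 1 + uR ((j : ℕ) + 2) 1 - uR (max (i : ℕ) j + 2) (min (i : ℕ) j + 2)

/-- `e^{(log a − log b)/2} = √a√b/b`, `e^{−(log a − log b)/2} = √a√b/a`. [folklore] -/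
theorem exp_half_log_sub {a b : ℕ} (ha : 0 < a) (hb : 0 < b) :
    Real.exp ((Real.log a - Real.log b) / 2) = Real.sqrt a * Real.sqrt b / b ∧
    Real.exp (-((Real.log a - Real.log b) / 2)) = Real.sqrt a * Real.sqrt b / a := by
  have ha' : (0 : ℝ) < a := by exact_mod_cast ha
  have hb' : (0 : ℝ) < b := by exact_mod_cast hb
  have hsa : Real.exp (Real.log a / 2) = Real.sqrt a := by
    rw [Real.sqrt_eq_rpow, Real.rpow_def_of_pos ha']; ring_nf
  have hsb : Real.exp (Real.log b / 2) = Real.sqrt b := by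
    rw [Real.sqrt_eq_rpow, Real.rpow_def_of_pos hb']; ring_nf
  have hqa : Real.sqrt a * Real.sqrt a = a := Real.mul_self_sqrt ha'.le
  have hqb : Real.sqrt b * Real.sqrt b = b := Real.mul_self_sqrt hb'.le
  have hsa0 : 0 < Real.sqrt a := Real.sqrt_pos.2 ha'
  have hsb0 : 0 < Real.sqrt b := Real.sqrt_pos.2 hb'
  constructor
  · rw [show (Real.log a - Real.log b) / 2 = Real.log a / 2 - Real.log b / 2 by ring, Real.exp_sub, hsa,
      hsb, div_eq_div_iff hsb0.ne' hb'.ne', mul_assoc, hqb]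
  · rw [show -((Real.log a - Real.log b) / 2) = Real.log b / 2 - Real.log a / 2 by ring, Real.exp_sub,
      hsa, hsb, div_eq_div_iff hsa0.ne' ha'.ne', mul_comm (Real.sqrt a) (Real.sqrt b), mul_assoc, hqa]

/-- **`Ψ(log(a/b))` in computable pieces** (`1 ≤ b < a`): archimedean part via `√a√b`, prime sum over
`n ≤ a/b`, linear term, and the geometric Hurwitz–Lerch series at `x = b²/a²`. [folklore] -/
theorem uR_eq {a b : ℕ} (hb : 0 < b) (hab : b < a) :
    uR a b = 4 * (Real.sqrt a * Real.sqrt b / b + Real.sqrt a * Real.sqrt b / a - 2)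
      - ∑ n ∈ Finset.Icc 1 (a / b),
          (ArithmeticFunction.vonMangoldt n : ℝ) / Real.sqrt n * ((Real.log a - Real.log b) - Real.log n)
      - (Real.log a - Real.log b) * slopeA / 2
      - Real.sqrt a * Real.sqrt b / a *
          (∑' k : ℕ, (((b * b : ℕ) : ℝ) / ((a * a : ℕ) : ℝ)) ^ k / ((k : ℝ) + 1 / 4) ^ 2) / 4 := by
  have ha : 0 < a := hb.trans hab
  have ha' : (0 : ℝ) < a := by exact_mod_cast ha
  have hb' : (0 : ℝ) < b := by exact_mod_cast hb
  have hlog : Real.log ((a : ℝ) / b) = Real.log a - Real.log b := Real.log_div ha'.ne' hb'.ne'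
  have htpos : 0 < Real.log a - Real.log b := by
    rw [← hlog]; exact Real.log_pos ((one_lt_div hb').2 (by exact_mod_cast hab))
  obtain ⟨he1, he2⟩ := exp_half_log_sub ha hb
  have hexp : Real.exp (Real.log a - Real.log b) = (a : ℝ) / b := by
    rw [Real.exp_sub, Real.exp_log ha', Real.exp_log hb']
  have hfloor : ⌊Real.exp (Real.log a - Real.log b)⌋₊ = a / b := by
    rw [hexp]; exact Nat.floor_div_eq_div a b
  have hprime : zetaScrewPrimeSum (Real.log a - Real.log b) = ∑ n ∈ Finset.Icc 1 (a / b),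
      (ArithmeticFunction.vonMangoldt n : ℝ) / Real.sqrt n * ((Real.log a - Real.log b) - Real.log n) := by
    unfold zetaScrewPrimeSum; rw [abs_of_pos htpos, hfloor]
  have hx : Real.exp (-(2 * (Real.log a - Real.log b))) = ((b * b : ℕ) : ℝ) / ((a * a : ℕ) : ℝ) := by
    rw [show -(2 * (Real.log a - Real.log b)) = ((2 : ℕ) : ℝ) * (Real.log b - Real.log a) by push_cast; ring,
      Real.exp_nat_mul, Real.exp_sub, Real.exp_log ha', Real.exp_log hb']
    push_cast; field_simp
  have hlerch : hurwitzLerchQuarter (Real.log a - Real.log b) =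
      ∑' k : ℕ, (((b * b : ℕ) : ℝ) / ((a * a : ℕ) : ℝ)) ^ k / ((k : ℝ) + 1 / 4) ^ 2 := by
    unfold hurwitzLerchQuarter
    rw [abs_of_pos htpos]
    refine tsum_congr fun k => ?_
    rw [show -(2 * (Real.log a - Real.log b) * k) = (k : ℝ) * (-(2 * (Real.log a - Real.log b))) by ring,
      Real.exp_nat_mul, hx]
  unfold uR
  rw [hlog, zetaScrew_eq, abs_of_pos htpos, he1, he2, hprime, hlerch]
  unfold lerchC slopeA
  ring

/-- **`u(a,b) ∈ uEncl a b`** (`1 ≤ b < a ≤ K ≤ 64`, valid logarithms, `A ∋` the slope). [folklore] -/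
theorem mem_uEncl {logs : List FI} {K : ℕ} (hL : ∀ n ≤ K, FI.mem (Real.log n) (lg logs n)) (hK : K ≤ 64)
    {A : FI} (hA : FI.mem slopeA A) {a b : ℕ} (hb : 0 < b) (hab : b < a) (haK : a ≤ K) :
    FI.mem (uR a b) (uEncl logs A a b) := by
  have ha : 0 < a := hb.trans hab
  rw [uR_eq hb hab]
  have hT : FI.mem (Real.log a - Real.log b) ((lg logs a).sub (lg logs b)) :=
    FI.mem_sub (hL a haK) (hL b (by omega))
  have hg : FI.mem (Real.sqrt a * Real.sqrt b) ((sqrtNat a).mul (sqrtNat b)) :=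
    FI.mem_mul (mem_sqrtNat a) (mem_sqrtNat b)
  have hs : FI.mem (Real.sqrt a * Real.sqrt b / b) (((sqrtNat a).mul (sqrtNat b)).divNat b) :=
    FI.mem_divNat hg hb
  have hs' : FI.mem (Real.sqrt a * Real.sqrt b / a) (((sqrtNat a).mul (sqrtNat b)).divNat a) :=
    FI.mem_divNat hg ha
  have h2 : FI.mem (2 : ℝ) (FI.ofInt 2) := by simpa using FI.mem_ofInt 2
  have harch : FI.mem (4 * (Real.sqrt a * Real.sqrt b / b + Real.sqrt a * Real.sqrt b / a - 2))
      ((((((sqrtNat a).mul (sqrtNat b)).divNat b).add (((sqrtNat a).mul (sqrtNat b)).divNat a)).sub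
        (FI.ofInt 2)).mulInt 4) := by
    have := FI.mem_mulInt (FI.mem_sub (FI.mem_add hs hs') h2) 4
    push_cast at this
    rw [mul_comm] at this
    exact this
  have hP := mem_primeSumEncl hL hK hT (m := a / b) ((Nat.div_le_self a b).trans haK)
  have hlin : FI.mem ((Real.log a - Real.log b) * slopeA / 2)
      ((((lg logs a).sub (lg logs b)).mul A).divNat 2) := FI.mem_divNat (FI.mem_mul hT hA) (by norm_num)
  have hler := FI.mem_divNat (FI.mem_mul hs' (mem_lerchEncl hab)) (n := 4) (by norm_num)
  have := FI.mem_sub (FI.mem_sub (FI.mem_sub harch hP) hlin) hler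
  push_cast at this ⊢
  exact this

/-- Table lookup in `uTable`. [folklore] -/
theorem ug_uTable {logs : List FI} {A : FI} {N a b : ℕ} (hba : b < a) (ha : a ≤ N + 1) :
    ug (uTable logs A N) a b = uEncl logs A a b := by
  unfold ug uTable
  have h1 : ((List.range (N + 2)).map fun a => (List.range a).map fun b => uEncl logs A a b).getD a [] =
      (List.range a).map fun b => uEncl logs A a b := by
    rw [List.getD_eq_getElem?_getD, List.getElem?_map, List.getElem?_range (by omega)]
    rfl
  rw [h1, List.getD_eq_getElem?_getD, List.getElem?_map, List.getElem?_range hba]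
  rfl

/-- `Ψ(log m) = u(m,1) + C/4`. [folklore] -/
theorem zetaScrew_log_nat (m : ℕ) : zetaScrew (Real.log m) = uR m 1 + lerchC / 4 := by
  unfold uR; simp

/-- Off-diagonal screw entries through `u(max, min)`: `Ψ(log(x+2) − log(y+2)) = u(max+2, min+2) + C/4`
(`Ψ` is even). [folklore] -/
theorem zetaScrew_log_sub_eq_uR {x y : ℕ} (hxy : x ≠ y) :
    zetaScrew (Real.log ((x + 2 : ℕ) : ℝ) - Real.log ((y + 2 : ℕ) : ℝ)) =
      uR (max x y + 2) (min x y + 2) + lerchC / 4 := by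
  have hx : ((x + 2 : ℕ) : ℝ) ≠ 0 := by positivity
  have hy : ((y + 2 : ℕ) : ℝ) ≠ 0 := by positivity
  unfold uR
  rcases lt_or_gt_of_ne hxy with h | h
  · rw [max_eq_right h.le, min_eq_left h.le, Real.log_div hy hx, ← zetaScrew_neg, neg_sub]
    ring
  · rw [max_eq_left h.le, min_eq_right h.le, Real.log_div hx hy]
    ring

/-- **The screw Gram matrix is `T(C)`.** [folklore] -/
theorem screwMatrix_eq_tMat (N : ℕ) : screwMatrix N = tMat lerchC N := by
  ext i j
  rw [screwMatrix_apply, zetaScrewKernel_def]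
  simp only [tMat, Matrix.of_apply]
  split_ifs with h
  · subst h
    rw [sub_self, zetaScrew_zero, sub_zero, zetaScrew_log_nat]
    ring
  · have h' : (i : ℕ) ≠ j := fun e => h (Fin.ext e)
    rw [zetaScrew_log_sub_eq_uR h', zetaScrew_log_nat, zetaScrew_log_nat]
    ring

/-- `T(c)` is symmetric. [folklore] -/
theorem tMat_isHermitian (c : ℝ) (N : ℕ) : (tMat c N).IsHermitian := by
  refine Matrix.IsHermitian.ext fun i j => ?_
  simp only [star_trivial, tMat, Matrix.of_apply]
  by_cases h : i = j
  · subst h; simp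
  · rw [if_neg (Ne.symm h), if_neg h, max_comm, min_comm]
    ring

/-- The rank-one trick: `T(C) = T(c) + ((C − c)/4)·(I + J)`. [folklore] -/
theorem tMat_split (C c : ℝ) (N : ℕ) :
    tMat C N = tMat c N + ((C - c) / 4) • (1 + Matrix.vecMulVec (fun _ : Fin N => (1 : ℝ)) fun _ => 1) := by
  ext i j
  simp only [tMat, Matrix.add_apply, Matrix.smul_apply, Matrix.of_apply, Matrix.one_apply,
    Matrix.vecMulVec_apply, smul_eq_mul]
  split_ifs <;> ring

/-- `I + J ⪰ 0`. [folklore] -/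
theorem one_add_vecMulVec_posSemidef (N : ℕ) :
    (1 + Matrix.vecMulVec (fun _ : Fin N => (1 : ℝ)) fun _ => 1).PosSemidef :=
  Matrix.PosSemidef.one.add (by
    simpa using Matrix.posSemidef_vecMulVec_self_star (fun _ : Fin N => (1 : ℝ)))

/-- From `x ∈ I`: `|x − mid I| ≤ rad I`. [folklore] -/
theorem abs_sub_midQ_le_radQ {x : ℝ} {I : FI} (h : FI.mem x I) :
    |x - ((midQ I : ℚ) : ℝ)| ≤ ((radQ I : ℚ) : ℝ) := by
  obtain ⟨h1, h2⟩ := h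
  have hS := SC_pos
  unfold midQ radQ
  push_cast
  rw [abs_sub_le_iff]
  constructor
  · rw [sub_le_iff_le_add,
      show (((I.hi : ℤ) : ℝ) - I.lo) / (2 * SC) + (((I.lo : ℤ) : ℝ) + I.hi) / (2 * SC) = I.hi / SC by ring,
      le_div_iff₀ hS]
    exact h2
  · rw [sub_le_comm,
      show (((I.lo : ℤ) : ℝ) + I.hi) / (2 * SC) - (((I.hi : ℤ) : ℝ) - I.lo) / (2 * SC) = I.lo / SC by ring,
      div_le_iff₀ hS]
    exact h1

/-- **The entries of `T(c_lo)` are enclosed by `tEncl`.** [folklore] -/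
theorem mem_tEncl {utab : List (List FI)} {N : ℕ}
    (hut : ∀ a b : ℕ, 0 < b → b < a → a ≤ N + 1 → FI.mem (uR a b) (ug utab a b))
    {i j : ℕ} (hi : i < N) (hj : j < N) :
    FI.mem (tMat ((cLoQ : ℚ) : ℝ) N ⟨i, hi⟩ ⟨j, hj⟩) (tEncl utab i j) := by
  have hc2 : FI.mem (((cLoQ : ℚ) : ℝ) / 2) (FI.ofRatRat (cLoQ / 2) (cLoQ / 2)) := by
    have := FI.mem_ofRatRat (x := ((cLoQ / 2 : ℚ) : ℝ)) le_rfl le_rfl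
    push_cast at this; exact this
  have hc4 : FI.mem (((cLoQ : ℚ) : ℝ) / 4) (FI.ofRatRat (cLoQ / 4) (cLoQ / 4)) := by
    have := FI.mem_ofRatRat (x := ((cLoQ / 4 : ℚ) : ℝ)) le_rfl le_rfl
    push_cast at this; exact this
  simp only [tMat, tEncl, Matrix.of_apply, Fin.mk.injEq]
  split_ifs with h
  · subst h
    have hu := hut (i + 2) 1 one_pos (by omega) (by omega)
    have := FI.mem_add hc2 (FI.mem_mulInt hu 2)
    push_cast at this
    rw [mul_comm] at this
    exact this
  · have hu1 := hut (i + 2) 1 one_pos (by omega) (by omega)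
    have hu2 := hut (j + 2) 1 one_pos (by omega) (by omega)
    have hu3 := hut (max i j + 2) (min i j + 2) (by omega) (by omega) (by omega)
    exact FI.mem_sub (FI.mem_add (FI.mem_add hc4 hu1) hu2) hu3

/-- Reading the centre table. [folklore] -/
theorem mreal_centreTab (utab : List (List FI)) {N i j : ℕ} (hi : i < N) (hj : j < N) :
    mreal (centreTab utab N) i j = ((midQ (tEncl utab i j) : ℚ) : ℝ) := by
  unfold mreal centreTab; rw [mget_mtab _ hi hj]

/-- Reading the radius table. [folklore] -/
theorem mreal_radiusTab (utab : List (List FI)) {N i j : ℕ} (hi : i < N) (hj : j < N) :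
    mreal (radiusTab utab N) i j = ((radQ (tEncl utab i j) : ℚ) : ℝ) := by
  unfold mreal radiusTab; rw [mget_mtab _ hi hj]

/-! ## Main soundness theorem -/

/-- **Soundness of the rung certificate checker**: `rungCheck N logs utab cert = true` implies that the
screw Gram matrix `S_{N+1} = screwMatrix N` is positive definite — unconditionally (no hypothesis on `ζ`).
[folklore] -/
theorem posDef_of_rungCheck {N : ℕ} {logs : List FI} {utab : List (List FI)} {cert : LDLCert}
    (h : rungCheck N logs utab cert = true) : (screwMatrix N).PosDef := by
  rcases Nat.eq_zero_or_pos N with rfl | hNpos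
  · exact screwMatrix_zero_posDef
  unfold rungCheck at h
  simp only [Bool.and_eq_true, decide_eq_true_eq] at h
  obtain ⟨⟨⟨⟨⟨hN, hlogs⟩, hok⟩, hslope⟩, hcheck⟩, hlam⟩ := h
  have hL := logsOK_of_eq hlogs hok
  split at hslope
  · exact absurd hslope (by simp)
  · rename_i A hA
    rw [decide_eq_true_eq] at hslope
    have hAv : FI.mem slopeA A := mem_slopeEncl hL (by omega) hA
    have hut : ∀ a b : ℕ, 0 < b → b < a → a ≤ N + 1 → FI.mem (uR a b) (ug utab a b) := by
      intro a b hb hba ha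
      rw [hslope, ug_uTable hba ha]
      exact mem_uEncl hL hN hAv hb hba ha
    have hΔ : ∀ i j : Fin N, |tMat ((cLoQ : ℚ) : ℝ) N i j - mreal (centreTab utab N) i j| ≤
        mreal (radiusTab utab N) i j := by
      intro i j
      rw [mreal_centreTab utab i.isLt j.isLt, mreal_radiusTab utab i.isLt j.isLt]
      exact abs_sub_midQ_le_radQ (mem_tEncl hut i.isLt j.isLt)
    have hpd : (tMat ((cLoQ : ℚ) : ℝ) N).PosDef :=
      posDef_of_checkLower hcheck (by exact_mod_cast hlam) (tMat_isHermitian _ _) hΔ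
    rw [screwMatrix_eq_tMat, tMat_split lerchC ((cLoQ : ℚ) : ℝ)]
    exact hpd.add_posSemidef ((one_add_vecMulVec_posSemidef N).smul
      (div_nonneg (sub_nonneg.2 cLoQ_le_lerchC) (by norm_num)))

/-- **Corollary**: a passing rung certificate makes every pivot `d_M`, `2 ≤ M ≤ N + 1`, positive — the
finite rungs of the RH-equivalent ladder `∀ M ≥ 2, d_M > 0` (`riemannHypothesis_iff_screwPivot_pos`),
unconditionally. [folklore] -/
theorem screwPivot_pos_of_rungCheck {N : ℕ} {logs : List FI} {utab : List (List FI)} {cert : LDLCert}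
    (h : rungCheck N logs utab cert = true) {M : ℕ} (hM : 2 ≤ M) (hMN : M ≤ N + 1) :
    0 < screwPivot M :=
  screwPivot_pos_of_posDef_le (posDef_of_rungCheck h) M hM hMN

end Summit.RiemannHypothesis.RiemannHypothesis.Theorems.IntegerScrew.RungCert
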